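import Summits.MatrixMultiplication.OmegaCensus.STPPVosperSlackTwoSoundCReduce
import Summits.MatrixMultiplication.OmegaCensus.STPPVosperSlackTwoRows333AAsm
import Summits.MatrixMultiplication.OmegaCensus.STPPVosperSlackTwoRows61BAsm
import Summits.MatrixMultiplication.OmegaCensus.STPPVosperSlackTwoRows61CAsm
import Summits.MatrixMultiplication.OmegaCensus.STPPHamidouneRodsethInverseTheorem

/-!
# ω-census (abelian STPP census): `{(3,3,3),(3,3,4)} ⊄ ℤ₆₁` — UNCONDITIONAL KERNEL KILL by the slack-2 partition law

HONEST FRAMING (pub-omega census; verbatim): lottery ticket; floor = certified bounds/negative ranges.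
Census STRUCTURE (seat pub-omega-stpp-2 gen 27, 2026-08-28; rows A by stpp-1 gen 32), family (b2).  `no_isSTPP_zmod61_333_334`: no STPP family
of `ℤ/61` has the size pattern `{(3,3,3),(3,3,4)}` (triples `(|Aᵢ|, |Bᵢ|, |Cᵢ|)`).  Proof: the slack-2 partition law for a one-other-block leaf,
`no_isSTPP_of_slack_two_rowsQ` (`STPPVosperSlackTwoSoundCReduce.lean`), applied to the role-rotated family `(C, A, B)` at the block `(3,3,4)` read as
`(a, b, c) = (4, 3, 3)` with the other block `(a₀, b₀, c₀) = (3, 3, 3)`, `L = z = 9`, `vol = 36`, `9 + 3 + 36 + 4 + 9 = 61`; its three row hypotheses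
are the kernel computations `rowsA333` (stpp-1, `…Rows333AAsm.lean`: 1 770 three-shapes, plain form, fed through `Or.inr`), `rowsB61_choose`
(`…Rows61BAsm.lean`: 34 220 four-shapes at their 4 495 dihedral representatives) and `rowsC61` (`…Rows61CAsm.lean`: 720 Hamidoune–Rødseth shape pairs);
Hamidoune–Rødseth is the tree theorem `hamidouneRodsethInverseTheorem_holds`.  Census consequence (lead's words, pre-stated): «ℤ₆₁ 53/54».  Nothing here
is progress on `ω`: a finite statement about subsets of `ℤ/61`.

References: H. Cohn, R. Kleinberg, B. Szegedy, C. Umans, FOCS 2005 (arXiv:math/0511460), Def. 5.1; A. G. Vosper, J. London Math. Soc. 31 (1956);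
Y. O. Hamidoune, Ø. J. Rødseth, Acta Arith. 92 (2000).
-/

open Finset
open scoped Pointwise

namespace Summit.MatrixMultiplication.OmegaCensus.CubeNB

open Literature.Computability.AlgebraicComplexity
open Literature.Combinatorics.Additive
open Summit.MatrixMultiplication.OmegaCensus.STPPKneser
open Summit.MatrixMultiplication.OmegaCensus.CubeNB.S2

/-- **`{(3,3,3),(3,3,4)} ⊄ ℤ₆₁` (kernel, unconditional).**  No simultaneous-triple-product family of `ℤ/61` has size pattern
`(|A₀|,|B₀|,|C₀|) = (3,3,3)`, `(|A₁|,|B₁|,|C₁|) = (3,3,4)`. [cite: CohnKleinbergSzegedyUmans2005, Def. 5.1]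
[cite: Vosper1956, main theorem; Nathanson1996, Thm 2.7] [cite: HamidouneRodseth2000, main theorem (§1, p. 252)] -/
theorem no_isSTPP_zmod61_333_334 (A B C : Fin 2 → Finset (ZMod 61)) (hS : IsSTPP A B C)
    (hA : ∀ i, #(A i) = ![3, 3] i) (hB : ∀ i, #(B i) = ![3, 3] i) (hC : ∀ i, #(C i) = ![3, 4] i) : False := by
  haveI : Fact (Nat.Prime 61) := ⟨by norm_num⟩
  have hS' : IsSTPP C A B := stpp_rotate (stpp_rotate hS)
  have hAne : ∀ i, (A i).Nonempty := fun i => card_pos.1 (by rw [hA]; fin_cases i <;> simp)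
  have hBne : ∀ i, (B i).Nonempty := fun i => card_pos.1 (by rw [hB]; fin_cases i <;> simp)
  have hCne : ∀ i, (C i).Nonempty := fun i => card_pos.1 (by rw [hC]; fin_cases i <;> simp)
  exact no_isSTPP_of_slack_two_rowsQ hamidouneRodsethInverseTheorem_holds hS' hCne hAne hBne 1 0 (by decide)
    (a := 4) (b := 3) (c := 3) (a₀ := 3) (b₀ := 3) (c₀ := 3) (L := 9) (z := 9) (vol := 36)
    (by rw [hC]; rfl) (by rw [hA]; rfl) (by rw [hB]; rfl) (by rw [hC]; rfl) (by rw [hA]; rfl) (by rw [hB]; rfl)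
    rfl rfl rfl rfl (by norm_num) (by norm_num) (by norm_num) (by norm_num) (by norm_num) (by norm_num)
    (fun Q hQ => Or.inr (rowsA333 Q hQ)) rowsB61_choose rowsC61

end Summit.MatrixMultiplication.OmegaCensus.CubeNB
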